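import Summits.QuantumFields.YangMills.Theorems.BalabanUVNodesPortZDTransportHomogeneity

/-!
# NODE O port, row PT-A′ helper lane (PTZ-1, gen 3): OPEN-WINDOW LOCALITY OF THE TRANSPORTS OF RECORD — the kernel transform reads its density only on the fibres over `U`
# (a.e. on an open set `U` of coarse fields), and the canonical-version transport `TcanOfRecord = TβOfRecord₁₃` inherits it POINTWISE at every `W ∈ U` whose averaging kernel lives
# on its fibre: the displayed hypothesis `hloc` of `…PortZDHistoryFluctuation` §2 (window `S := Ū⁻¹(U)`) DISCHARGED at the record's transport modulo that one kernel condition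

[Balaban1987RG1] = [I] (CMP 109, 1987): (0.13) p. 254 («∫ dU Π_c δ(Ū(c)V⁻¹(c)) ρ(U)» — the transform reads `ρ` on the fibre), (0.19) p. 255, (2.14) p. 268; [Balaban1988Convergent] = [III]
(CMP 119, 1988): (3.1) p. 264.

Seat `ymgap-nodeO-port-PTZ-1` g3 (prover, HELPER MODE; `--supports stmt-QuantumFields-27930 --as helper`).  Generic layer (no token of the χ-cone of record); CRIT-1 Q-5 (β).  Companion of
`…PortZDTransportHomogeneity` (✓p805757: `transportOfRecord_congr_window`, `transportOfRecord_fibre_window_ae`, `hT_TcanOfRecord`).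
WHAT IS PROVED (0 sorry; no `def` ∕ `instance` ∕ `notation`):
* §1 `transportOfRecord_eq_zero_of_avgDensity_eq_zero` — where the marginal density vanishes the kernel transform vanishes; ★ `transportOfRecord_ae_congr_of_eqOn_preimage` — for `k < K`
  and ANY set `U` of coarse fields: two densities that agree on `Ū⁻¹(U)` have kernel transforms that agree at `dV`-almost every `V ∈ U` (the averaging kernel lives on the fibre for
  `(dU.map Ū)`-a.e. `V` — `transportOfRecord_fibre_window_ae` — transferred to `dV`-a.e. through the marginal density, `T4AveragingDisintegration.withDensity_margDensity` + `ae_withDensity_iff`).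
* §2 ★★ `TcanOfRecord_congr_openWindow` — for `k < K`, `U` OPEN (in the Pi topology of the raw configuration type `PBond → SU N`, as in `Node00/CanonicalTransportOfRecord`), `W ∈ U` with `avgKernel W (fibre W)ᶜ = 0` (the kernel form of `δ(ŪW⁻¹)` AT `W`; true for a.e. `W`), two densities that
  agree on `Ū⁻¹(U)` have `TcanOfRecord ρ W = TcanOfRecord ρ′ W` — three cases: `W ∈ regSet ρ` or `W ∈ regSet ρ′` (determinacy of continuous versions on the open set `U ∩ regSet`,
  `Node00.TcanOfRecord_eqOn_of_continuousOn`), or neither (both read the kernel transform verbatim, `TcanOfRecord_eq_of_not_mem` + the kernel condition at `W`);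
  `hloc_TcanOfRecord_openWindow` — the literal `hloc` shape of `PortZD.stepOutT_add_sub_eq_of_windowConst` ∕ `PortZDRecord.recordChannel_eq_zero_of_windowConst` with `S := Ū⁻¹(U)`.
LOCATED (said, not claimed): the kernel-on-fibre condition AT A GIVEN `W` (e.g. `W = 1`) is the pointwise face of the `δ`-function that the tree's disintegration supplies only a.e.
(node00 (F2) «fibrewise level-set» species); it stays displayed.

HONEST FRAMING.  Measure bookkeeping (`ae_withDensity_iff`, `ae_restrict_iff'`, determinacy of continuous versions); NOTHING of Bałaban's estimates asserted, ported or discharged; no named fact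
introduced; 26648 ∕ 27930⁸ SIGNED·OPEN (content-gated), 27931 OPEN (RC-3), 27932 CLOSED; K0⁷ ∕ K-Ax OPEN; counts unmoved; finite 𝕋⁴ at fixed ε — NOT continuum ∕ OS ∕ Clay; the Yang–Mills
mass gap is NOT proved by any of this.  No `sorry`, no `instance`, no `notation`, no `def`.
-/

noncomputable section

open MeasureTheory Set

namespace Summit.QuantumFields.YangMills.Theorems.PortZD

open Literature.MathematicalPhysics.QuantumFieldTheory.Balaban1983to89
open Literature.MathematicalPhysics.QuantumFieldTheory.Balaban1983to89.Node00
open T4Continuum (T4Family)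

variable (F : T4Family) (N : ℕ) [NeZero N]

/-! ## §1. The kernel transform reads its density only on the fibres over `U`, for almost every coarse field in `U` -/

/-- Where the marginal density of the averaging vanishes, the kernel transform vanishes (whatever the density). [cite: Balaban1988Convergent, (3.1) p.264 (bookkeeping)] -/
theorem transportOfRecord_eq_zero_of_avgDensity_eq_zero {K k : ℕ} (ρ : Density (F.P K) k (SU N)) {V : GaugeField (F.P K) (k + 1) (SU N)}
    (hV : T4AveragingDisintegration.avgDensity (avOfRecord F N K k).avg V = 0) : transportOfRecord F N K k ρ V = 0 := by
  show (T4AveragingDisintegration.avgDensity (avOfRecord F N K k).avg V : ℝ) * ∫ U, ρ U ∂(T4AveragingDisintegration.avgKernel (avOfRecord F N K k).avg V) = 0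
  rw [hV, NNReal.coe_zero, zero_mul]

/-- ★ **TWO DENSITIES THAT AGREE ON `Ū⁻¹(U)` HAVE KERNEL TRANSFORMS THAT AGREE AT ALMOST EVERY COARSE FIELD OF `U`** (`k < K`; any set `U`): at `dV`-a.e. `V` either the marginal
density vanishes (both transforms are `0`) or the averaging kernel lives on the fibre `{Ū = V} ⊆ Ū⁻¹(U)`. [cite: Balaban1987RG1, (0.13) p.254; Balaban1988Convergent, (3.1) p.264 (bookkeeping)] -/
theorem transportOfRecord_ae_congr_of_eqOn_preimage {K k : ℕ} (hk : k < K) (U : Set (GaugeField (F.P K) (k + 1) (SU N))) {ρ ρ' : Density (F.P K) k (SU N)}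
    (h : ∀ Uf : GaugeField (F.P K) k (SU N), (avOfRecord F N K k).avg Uf ∈ U → ρ Uf = ρ' Uf) :
    ∀ᵐ V ∂(fieldMeasure (F.P K) (k + 1) (SU N)), V ∈ U → transportOfRecord F N K k ρ V = transportOfRecord F N K k ρ' V := by
  have hfib := transportOfRecord_fibre_window_ae F N K k
  rw [← T4AveragingDisintegration.withDensity_margDensity (fieldMeasure (F.P K) k (SU N)) (fieldMeasure (F.P K) (k + 1) (SU N))
      (avOfRecord_measurable F N K k) (avOfRecord_haarAC F N K k hk),
    ae_withDensity_iff T4AveragingDisintegration.measurable_margDensity.coe_nnreal_ennreal] at hfib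
  filter_upwards [hfib] with V hV hVU
  by_cases hd : T4AveragingDisintegration.avgDensity (avOfRecord F N K k).avg V = 0
  · rw [transportOfRecord_eq_zero_of_avgDensity_eq_zero F N ρ hd, transportOfRecord_eq_zero_of_avgDensity_eq_zero F N ρ' hd]
  · have hne : (T4AveragingDisintegration.avgDensity (avOfRecord F N K k).avg V : ENNReal) ≠ 0 := by
      rwa [Ne, ENNReal.coe_eq_zero]
    exact transportOfRecord_congr_window F N (hV hne) fun Uf hUf => h Uf (by rw [show (avOfRecord F N K k).avg Uf = V from hUf]; exact hVU)

/-! ## §2. The canonical-version transport inherits open-window locality pointwise -/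

/-- ★★ **OPEN-WINDOW LOCALITY OF `TcanOfRecord`**: `k < K`, `U` open, `W ∈ U`, the averaging kernel AT `W` living on the fibre of `W`; then two densities that agree on `Ū⁻¹(U)`
have the same canonical-version transform AT `W`. [cite: Balaban1987RG1, (0.13) p.254, (0.19) p.255; Balaban1988Convergent, (3.1) p.264 (bookkeeping)] -/
theorem TcanOfRecord_congr_openWindow {K k : ℕ} (hk : k < K) {U : Set (PBond (F.P K) (k + 1) → SU N)} (hU : IsOpen U)
    {W : PBond (F.P K) (k + 1) → SU N} (hW : W ∈ U)
    (hker : T4AveragingDisintegration.avgKernel (avOfRecord F N K k).avg W {Uf | (avOfRecord F N K k).avg Uf = W}ᶜ = 0)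
    {ρ ρ' : Density (F.P K) k (SU N)} (h : ∀ Uf : GaugeField (F.P K) k (SU N), (avOfRecord F N K k).avg Uf ∈ U → ρ Uf = ρ' Uf) :
    TcanOfRecord F N K k ρ W = TcanOfRecord F N K k ρ' W := by
  haveI := isOpenPosMeasure_piHaar_SUN N (F.P K) (k + 1)
  -- the two kernel transforms agree a.e. on `U`
  have hae : ∀ᵐ V ∂(piHaar (F.P K) (k + 1) (SU N)).restrict U,
      transportOfRecord F N K k ρ V = transportOfRecord F N K k ρ' V :=
    (ae_restrict_iff' hU.measurableSet).2 (transportOfRecord_ae_congr_of_eqOn_preimage F N hk U h)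
  -- symmetric determinacy step: `W ∈ regSet ρ₁` forces `Tcan ρ₂ W = Tcan ρ₁ W`
  have step : ∀ {ρ₁ ρ₂ : Density (F.P K) k (SU N)},
      (∀ᵐ V ∂(piHaar (F.P K) (k + 1) (SU N)).restrict U, transportOfRecord F N K k ρ₁ V = transportOfRecord F N K k ρ₂ V) →
      W ∈ regSetOfRecord F N K k ρ₁ → TcanOfRecord F N K k ρ₂ W = TcanOfRecord F N K k ρ₁ W := by
    intro ρ₁ ρ₂ h12 hW1
    have hO : IsOpen (U ∩ regSetOfRecord F N K k ρ₁) := hU.inter (isOpen_regSetOfRecord K k ρ₁)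
    have hcont : ContinuousOn (TcanOfRecord F N K k ρ₁) (U ∩ regSetOfRecord F N K k ρ₁) :=
      (continuousOn_TcanOfRecord K k ρ₁).mono inter_subset_right
    have hae₁ : TcanOfRecord F N K k ρ₁ =ᵐ[(piHaar (F.P K) (k + 1) (SU N)).restrict (U ∩ regSetOfRecord F N K k ρ₁)]
        fun V => transportOfRecord F N K k ρ₂ V := by
      have ha : (fun V => TcanOfRecord F N K k ρ₁ V) =ᵐ[(piHaar (F.P K) (k + 1) (SU N)).restrict (U ∩ regSetOfRecord F N K k ρ₁)]
          fun V => transportOfRecord F N K k ρ₁ V := ae_restrict_of_ae (TcanOfRecord_ae_eq K k ρ₁)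
      have hb : (fun V => transportOfRecord F N K k ρ₁ V) =ᵐ[(piHaar (F.P K) (k + 1) (SU N)).restrict (U ∩ regSetOfRecord F N K k ρ₁)]
          fun V => transportOfRecord F N K k ρ₂ V := ae_restrict_of_ae_restrict_of_subset inter_subset_left h12
      exact ha.trans hb
    exact TcanOfRecord_eqOn_of_continuousOn hO hcont hae₁ ⟨hW, hW1⟩
  by_cases h1 : W ∈ regSetOfRecord F N K k ρ
  · exact (step hae h1).symm
  by_cases h2 : W ∈ regSetOfRecord F N K k ρ'
  · have hae' : ∀ᵐ V ∂(piHaar (F.P K) (k + 1) (SU N)).restrict U,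
        transportOfRecord F N K k ρ' V = transportOfRecord F N K k ρ V := by
      filter_upwards [hae] with V hV; exact hV.symm
    exact step hae' h2
  · -- neither: both read the kernel transform verbatim, which is local through the fibre at `W`
    rw [TcanOfRecord_eq_of_not_mem ρ h1, TcanOfRecord_eq_of_not_mem ρ' h2]
    exact transportOfRecord_congr_window F N hker fun Uf hUf => h Uf (by rw [show (avOfRecord F N K k).avg Uf = W from hUf]; exact hW)

/-- **The displayed `hloc` of `PortZD.stepOutT_add_sub_eq_of_windowConst` ∕ `PortZDRecord.recordChannel_eq_zero_of_windowConst` in its literal shape, AT `TcanOfRecord`, with the window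
`S := Ū⁻¹(U)`** (`U` open ∋ `W`, kernel-on-fibre at `W`, `k < K`). [cite: Balaban1987RG1, (0.13) p.254, (2.14) p.268 (bookkeeping)] -/
theorem hloc_TcanOfRecord_openWindow {K k : ℕ} (hk : k < K) {U : Set (PBond (F.P K) (k + 1) → SU N)} (hU : IsOpen U)
    {W : PBond (F.P K) (k + 1) → SU N} (hW : W ∈ U)
    (hker : T4AveragingDisintegration.avgKernel (avOfRecord F N K k).avg W {Uf | (avOfRecord F N K k).avg Uf = W}ᶜ = 0) :
    ∀ ρ ρ' : Density (F.P K) k (SU N), (∀ Uf ∈ (avOfRecord F N K k).avg ⁻¹' U, ρ Uf = ρ' Uf) →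
      TcanOfRecord F N K k ρ W = TcanOfRecord F N K k ρ' W :=
  fun _ _ h => TcanOfRecord_congr_openWindow F N hk hU hW hker fun Uf hUf => h Uf hUf

end Summit.QuantumFields.YangMills.Theorems.PortZD

end
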